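import Summits.QuantumFields.YangMills.Theorems.UnitScaleTiltProp7BlockMeanContraction
import HarnessLib

/-!
# (q-gauge) SUPPLIER, ROW (T2) LETTER — **THE k-FOLD BLOCK Ad-AVERAGE OF A SITE SPIKE HAS `ℓ¹`-MASS ≤ `(L^d)^{−k}·‖A‖`, HENCE SUP `≤ (L^d)^{−k}·‖A‖ = ℓ⁻³‖A‖`**
# (the averaged gauge parameter `N⁽ᵏ⁾` of ✓`Prop7SymAvgTwSGaugeDir.QTwS_gaugeDir_of_avgSeq` — the recursion `ns (j+1) y = ns j ŷ − mean_i(ns j ŷ − Ad_{P_i} ns j x_i(y))` — at `ns 0 = δ_x ⊗ A`;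
# [Balaban1985Averaging] (11) p.19, (97) p.32; [Balaban1985BackgroundPropagators] (3.19) p.393 «N⁽ᵏ⁾ = Q′λ»)

Cell `ym3-torus` (HUMAN RULING D-0037, YM ladder rung R3 — SU(2) YM₃ on T³: NOT d = 4, NOT infinite volume, NOT a mass gap, NOT Clay).  Width seat `ym3-torus-px19` (gen 14);
chair ★`ym-ust-19200-p1` g27 WORD №29 (2); px19 g14 S1-SPEC (19200 evidence #54) row (T2), first letter (`‖N⁽ᵏ⁾‖ ≤ ℓ⁻³‖A‖`).  THEOREMS ONLY (0 `def`, 0 `sorry`, default heartbeats);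
`--supports stmt-QuantumFields-19200 --as helper`; count-neutral.

WHY.  In the second-order gauge-covariance identity (S1-SPEC (2)) the coarse BCH cross term (T2) is bilinear in `QTwS Y (c)` (`O(ℓ)·sup‖Y‖`) and the averaged parameter `N⁽ᵏ⁾(ĉ±)`; for a
site spike `N = δ_x ⊗ A` the averaged parameter is supported on the one block containing `x` with size `(L^d)^{−k}‖A‖ = ℓ⁻³‖A‖` — the two `ℓ`-powers give (T2)'s `ℓ⁻²`.  This file proves
the size statement for the GENERIC averaging recursion of ✓`QTwS_gaugeDir_of_avgSeq` (any level fields `V j` whose stair holonomies are norm-non-expanding, e.g. the `SU(2)`-valued background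
tower ✓`Prop7DbarTwSymUnitary.dbarCovIterU_emlIterU_mem_specialUnitaryGroup_of_plaqSmall`), by the block-mean bookkeeping of ✓`Prop7BlockMeanContraction` (`x_i(y) = blockSite y i.1`,
index mean = block mean, blocks tile the torus).

WHAT IS PROVED (generic `P : Params`, normed ℂ-algebra `𝔸`).
* §1 `norm_conj_le` (`‖P·M·P⁻¹‖ ≤ ‖M‖` for `‖P‖, ‖P⁻¹‖ ≤ 1`), `meanCLM_const` (`mean_i c = c`), `avgStep_eq_mean` (the recursion IS the mean of the transported values).
* §2 ★★ `sum_norm_avgStep_le` — ONE LEVEL: `Σ_y ‖ns′ y‖ ≤ (L^d)⁻¹·Σ_x ‖ns x‖` (standing range `j + 1 ≤ m + K`).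
* §3 ★★★ `sum_norm_avgSeq_le` — k LEVELS: `Σ_y ‖ns k y‖ ≤ ((L^d)⁻¹)^k·Σ_x ‖ns 0 x‖`; ★★★ `norm_avgSeq_spike_le` — spike edition: `ns 0 = Pi.single x A` ⟹ `∀ y, ‖ns k y‖ ≤ ((L^d)⁻¹)^k·‖A‖`.
HONEST SCOPE.  Finite bookkeeping; the holonomy norm letters are DISPLAYED (unitary towers discharge them); nothing of (q-gauge)-core, `hqG`, norm_G, EX, the crux or rung R3 is proved; the
Yang–Mills mass gap is NOT proved.

References: T. Bałaban, CMP **98** (1985) 17–51 [Balaban1985Averaging] ((11) p.19, (82) p.30, (97) p.32); CMP **99** (1985) 389–434 [Balaban1985BackgroundPropagators] ((3.19) p.393);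
CMP **109** (1987) 249–301 [Balaban1987RG1] ((0.3)–(0.4) pp.252–253).
-/

set_option autoImplicit false

noncomputable section

open scoped BigOperators

namespace Summit.QuantumFields.YangMills.Theorems.Prop7AvgSeqSpikeMass

open Finset
open Literature.MathematicalPhysics.QuantumFieldTheory.Balaban1983to89
open T4Continuum T4ReflectionCone BlockAveraging AveragingRT
open B10Eq27TorusAxialLog (holT transl)
open B7Prop1Explicit (disp)
open B7TransferAnalyticMean (meanCLM meanCLM_apply)
open Summit.QuantumFields.YangMills.Theorems.LinearLiftGauge (card_Idx sum_blockSite_eq)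
open Summit.QuantumFields.YangMills.Theorems.Prop7BlockMeanContraction (idxMean_eq_blockMean sum_sum_block_eq)

variable {P : Params} {𝔸 : Type*} [NormedRing 𝔸] [NormedAlgebra ℂ 𝔸]

/-! ## §1 Letters -/

omit [NormedAlgebra ℂ 𝔸] in
/-- `‖P·M·P⁻¹‖ ≤ ‖M‖` for a unit `P` with `‖P‖ ≤ 1`, `‖P⁻¹‖ ≤ 1`. [folklore] -/
theorem norm_conj_le {Q : 𝔸ˣ} (h₁ : ‖(Q : 𝔸)‖ ≤ 1) (h₂ : ‖((Q⁻¹ : 𝔸ˣ) : 𝔸)‖ ≤ 1) (M : 𝔸) : ‖(Q : 𝔸) * M * ((Q⁻¹ : 𝔸ˣ) : 𝔸)‖ ≤ ‖M‖ := by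
  calc ‖(Q : 𝔸) * M * ((Q⁻¹ : 𝔸ˣ) : 𝔸)‖ ≤ ‖(Q : 𝔸)‖ * ‖M‖ * ‖((Q⁻¹ : 𝔸ˣ) : 𝔸)‖ :=
        (norm_mul_le _ _).trans (mul_le_mul_of_nonneg_right (norm_mul_le _ _) (norm_nonneg _))
    _ ≤ 1 * ‖M‖ * 1 := by gcongr
    _ = ‖M‖ := by ring

/-- The index family is non-empty as a real cardinal: `0 < |Idx P|` (`|Idx| = L^d·(d!)²`, `1 ≤ L`). [folklore] -/
theorem card_Idx_pos : (0 : ℝ) < (Fintype.card (Idx P) : ℝ) := by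
  have h : 0 < Fintype.card (Idx P) := Fintype.card_pos
  exact_mod_cast h

/-- The mean of a constant family is the constant. [folklore] -/
theorem meanCLM_const (c : 𝔸) : meanCLM (Idx P) 𝔸 (fun _ : Idx P => c) = c := by
  rw [meanCLM_apply, sum_const, card_univ, ← Nat.cast_smul_eq_nsmul ℂ, smul_smul]
  have hc : ((Fintype.card (Idx P) : ℂ)) ≠ 0 := by
    have := (card_Idx_pos (P := P)).ne'
    exact_mod_cast this
  rw [inv_mul_cancel₀ hc, one_smul]

/-- **THE RECURSION IS THE MEAN OF THE TRANSPORTED VALUES**: `ns ŷ − mean_i (ns ŷ − P_i·ns(x_i)·P_i⁻¹) = mean_i (P_i·ns(x_i)·P_i⁻¹)`. [cite: Balaban1985Averaging, (97) p.32] -/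
theorem avgStep_eq_mean {j : ℕ} (V : GaugeField P j 𝔸ˣ) (ns : Site P j → 𝔸) (y : Site P (j + 1)) :
    ns (emb y) - meanCLM (Idx P) 𝔸 (fun i : Idx P =>
        ns (emb y) - ((holT V (emb y) (stairWord i.2.1 (off i.1)) : 𝔸ˣ) : 𝔸) * ns (transl (emb y) (disp (stairWord i.2.1 (off i.1))))
          * (((holT V (emb y) (stairWord i.2.1 (off i.1)))⁻¹ : 𝔸ˣ) : 𝔸))
      = meanCLM (Idx P) 𝔸 (fun i : Idx P =>
          ((holT V (emb y) (stairWord i.2.1 (off i.1)) : 𝔸ˣ) : 𝔸) * ns (transl (emb y) (disp (stairWord i.2.1 (off i.1))))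
            * (((holT V (emb y) (stairWord i.2.1 (off i.1)))⁻¹ : 𝔸ˣ) : 𝔸)) := by
  have hsplit : (fun i : Idx P =>
        ns (emb y) - ((holT V (emb y) (stairWord i.2.1 (off i.1)) : 𝔸ˣ) : 𝔸) * ns (transl (emb y) (disp (stairWord i.2.1 (off i.1))))
          * (((holT V (emb y) (stairWord i.2.1 (off i.1)))⁻¹ : 𝔸ˣ) : 𝔸))
      = (fun _ : Idx P => ns (emb y)) - (fun i : Idx P =>
          ((holT V (emb y) (stairWord i.2.1 (off i.1)) : 𝔸ˣ) : 𝔸) * ns (transl (emb y) (disp (stairWord i.2.1 (off i.1))))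
            * (((holT V (emb y) (stairWord i.2.1 (off i.1)))⁻¹ : 𝔸ˣ) : 𝔸)) := by
    funext i; rfl
  rw [hsplit, map_sub, meanCLM_const, sub_sub_cancel]

/-! ## §2 One level: the block mean contracts the `ℓ¹`-mass by `(L^d)⁻¹` -/

/-- ★★ **ONE AVERAGING LEVEL CONTRACTS THE SITE MASS BY `(L^d)⁻¹`**: if `ns′ y = ns ŷ − mean_i(ns ŷ − P_i ns(x_i) P_i⁻¹)` with norm-non-expanding stair holonomies `P_i = V(Γ_{y,i})`,
then `Σ_y ‖ns′ y‖ ≤ (L^d)⁻¹·Σ_x ‖ns x‖` (standing range). [cite: Balaban1985Averaging, (97) p.32; Balaban1987RG1, (0.3)–(0.4) pp.252–253] -/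
theorem sum_norm_avgStep_le {j : ℕ} (hj : j + 1 ≤ P.m + P.K) (V : GaugeField P j 𝔸ˣ)
    (hV : ∀ (y : Site P (j + 1)) (i : Idx P), ‖((holT V (emb y) (stairWord i.2.1 (off i.1)) : 𝔸ˣ) : 𝔸)‖ ≤ 1 ∧
      ‖(((holT V (emb y) (stairWord i.2.1 (off i.1)))⁻¹ : 𝔸ˣ) : 𝔸)‖ ≤ 1)
    (ns : Site P j → 𝔸) (ns' : Site P (j + 1) → 𝔸)
    (hsucc : ∀ y : Site P (j + 1), ns' y = ns (emb y) - meanCLM (Idx P) 𝔸 (fun i : Idx P =>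
        ns (emb y) - ((holT V (emb y) (stairWord i.2.1 (off i.1)) : 𝔸ˣ) : 𝔸) * ns (transl (emb y) (disp (stairWord i.2.1 (off i.1))))
          * (((holT V (emb y) (stairWord i.2.1 (off i.1)))⁻¹ : 𝔸ˣ) : 𝔸))) :
    ∑ y : Site P (j + 1), ‖ns' y‖ ≤ ((P.L : ℝ) ^ P.d)⁻¹ * ∑ x : Site P j, ‖ns x‖ := by
  -- pointwise: `‖ns′ y‖ ≤ |Idx|⁻¹ Σ_i ‖ns(x_i(y))‖ = (L^d)⁻¹ Σ_r ‖ns(blockSite y r)‖`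
  have hpt : ∀ y : Site P (j + 1), ‖ns' y‖ ≤ ((P.L : ℝ) ^ P.d)⁻¹ * ∑ r : Fin P.d → Fin P.L, ‖ns (Site.blockSite y r)‖ := by
    intro y
    rw [hsucc y, avgStep_eq_mean, meanCLM_apply, ← idxMean_eq_blockMean (fun x => ‖ns x‖) y]
    have hcard : ‖((Fintype.card (Idx P) : ℂ))⁻¹‖ = (Fintype.card (Idx P) : ℝ)⁻¹ := by
      rw [norm_inv, Complex.norm_natCast]
    calc ‖((Fintype.card (Idx P) : ℂ))⁻¹ • ∑ i : Idx P, ((holT V (emb y) (stairWord i.2.1 (off i.1)) : 𝔸ˣ) : 𝔸) * ns (transl (emb y) (disp (stairWord i.2.1 (off i.1))))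
            * (((holT V (emb y) (stairWord i.2.1 (off i.1)))⁻¹ : 𝔸ˣ) : 𝔸)‖
        ≤ (Fintype.card (Idx P) : ℝ)⁻¹ * ∑ i : Idx P, ‖((holT V (emb y) (stairWord i.2.1 (off i.1)) : 𝔸ˣ) : 𝔸) * ns (transl (emb y) (disp (stairWord i.2.1 (off i.1))))
            * (((holT V (emb y) (stairWord i.2.1 (off i.1)))⁻¹ : 𝔸ˣ) : 𝔸)‖ := by
          rw [← hcard]; exact (norm_smul_le _ _).trans (mul_le_mul_of_nonneg_left (norm_sum_le _ _) (norm_nonneg _))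
      _ ≤ (Fintype.card (Idx P) : ℝ)⁻¹ * ∑ i : Idx P, ‖ns (transl (emb y) (disp (stairWord i.2.1 (off i.1))))‖ :=
          mul_le_mul_of_nonneg_left (sum_le_sum fun i _ => norm_conj_le (hV y i).1 (hV y i).2 _) (inv_nonneg.2 (card_Idx_pos (P := P)).le)
  calc ∑ y : Site P (j + 1), ‖ns' y‖ ≤ ∑ y : Site P (j + 1), ((P.L : ℝ) ^ P.d)⁻¹ * ∑ r : Fin P.d → Fin P.L, ‖ns (Site.blockSite y r)‖ := sum_le_sum fun y _ => hpt y
    _ = ((P.L : ℝ) ^ P.d)⁻¹ * ∑ y : Site P (j + 1), ∑ x ∈ block y, ‖ns x‖ := by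
        rw [mul_sum]; exact sum_congr rfl fun y _ => by rw [sum_blockSite_eq hj y (fun x => ‖ns x‖)]
    _ = ((P.L : ℝ) ^ P.d)⁻¹ * ∑ x : Site P j, ‖ns x‖ := by rw [sum_sum_block_eq]

/-! ## §3 k levels, and the spike -/

/-- ★★★ **k AVERAGING LEVELS CONTRACT THE SITE MASS BY `(L^d)^{−k}`**: for an averaging sequence `ns` (the recursion at every level `j < k` with norm-non-expanding holonomies of the
level-`j` fields `V j`), `Σ_y ‖ns k y‖ ≤ ((L^d)⁻¹)^k·Σ_x ‖ns 0 x‖` (standing range `k ≤ m + K`). [cite: Balaban1985Averaging, (11) p.19, (97) p.32] -/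
theorem sum_norm_avgSeq_le (V : (j : ℕ) → GaugeField P j 𝔸ˣ)
    (hV : ∀ (j : ℕ) (y : Site P (j + 1)) (i : Idx P), ‖((holT (V j) (emb y) (stairWord i.2.1 (off i.1)) : 𝔸ˣ) : 𝔸)‖ ≤ 1 ∧
      ‖(((holT (V j) (emb y) (stairWord i.2.1 (off i.1)))⁻¹ : 𝔸ˣ) : 𝔸)‖ ≤ 1)
    (ns : (j : ℕ) → Site P j → 𝔸)
    (hsucc : ∀ (j : ℕ) (y : Site P (j + 1)), ns (j + 1) y = ns j (emb y) - meanCLM (Idx P) 𝔸 (fun i : Idx P =>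
        ns j (emb y) - ((holT (V j) (emb y) (stairWord i.2.1 (off i.1)) : 𝔸ˣ) : 𝔸) * ns j (transl (emb y) (disp (stairWord i.2.1 (off i.1))))
          * (((holT (V j) (emb y) (stairWord i.2.1 (off i.1)))⁻¹ : 𝔸ˣ) : 𝔸))) :
    ∀ k : ℕ, k ≤ P.m + P.K → ∑ y : Site P k, ‖ns k y‖ ≤ (((P.L : ℝ) ^ P.d)⁻¹) ^ k * ∑ x : Site P 0, ‖ns 0 x‖
  | 0, _ => by rw [pow_zero, one_mul]
  | k + 1, hk => by
    have ih := sum_norm_avgSeq_le V hV ns hsucc k (by omega)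
    have hstep := sum_norm_avgStep_le hk (V k) (hV k) (ns k) (ns (k + 1)) (hsucc k)
    have hL : 0 ≤ ((P.L : ℝ) ^ P.d)⁻¹ := by positivity
    calc ∑ y : Site P (k + 1), ‖ns (k + 1) y‖ ≤ ((P.L : ℝ) ^ P.d)⁻¹ * ∑ x : Site P k, ‖ns k x‖ := hstep
      _ ≤ ((P.L : ℝ) ^ P.d)⁻¹ * ((((P.L : ℝ) ^ P.d)⁻¹) ^ k * ∑ x : Site P 0, ‖ns 0 x‖) := mul_le_mul_of_nonneg_left ih hL
      _ = (((P.L : ℝ) ^ P.d)⁻¹) ^ (k + 1) * ∑ x : Site P 0, ‖ns 0 x‖ := by ring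

/-- ★★★ **THE AVERAGED SITE SPIKE**: `ns 0 = δ_x ⊗ A` ⟹ `‖ns k y‖ ≤ ((L^d)⁻¹)^k·‖A‖` for every level-`k` site `y` (`k ≤ m + K`) — at the member's top level `k = K − n` this is `ℓ⁻³‖A‖`,
the size of the frame-corrected gauge parameter `N⁽ᵏ⁾` of a spike ((T2)∕(T3) of S1-SPEC). [cite: Balaban1985Averaging, (11) p.19, (97) p.32; Balaban1985BackgroundPropagators, (3.19) p.393] -/
theorem norm_avgSeq_spike_le [DecidableEq (Site P 0)] (V : (j : ℕ) → GaugeField P j 𝔸ˣ)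
    (hV : ∀ (j : ℕ) (y : Site P (j + 1)) (i : Idx P), ‖((holT (V j) (emb y) (stairWord i.2.1 (off i.1)) : 𝔸ˣ) : 𝔸)‖ ≤ 1 ∧
      ‖(((holT (V j) (emb y) (stairWord i.2.1 (off i.1)))⁻¹ : 𝔸ˣ) : 𝔸)‖ ≤ 1)
    (x : Site P 0) (A : 𝔸) (ns : (j : ℕ) → Site P j → 𝔸) (h0 : ns 0 = Pi.single x A)
    (hsucc : ∀ (j : ℕ) (y : Site P (j + 1)), ns (j + 1) y = ns j (emb y) - meanCLM (Idx P) 𝔸 (fun i : Idx P =>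
        ns j (emb y) - ((holT (V j) (emb y) (stairWord i.2.1 (off i.1)) : 𝔸ˣ) : 𝔸) * ns j (transl (emb y) (disp (stairWord i.2.1 (off i.1))))
          * (((holT (V j) (emb y) (stairWord i.2.1 (off i.1)))⁻¹ : 𝔸ˣ) : 𝔸)))
    {k : ℕ} (hk : k ≤ P.m + P.K) (y : Site P k) :
    ‖ns k y‖ ≤ (((P.L : ℝ) ^ P.d)⁻¹) ^ k * ‖A‖ := by
  have hmass : ∑ z : Site P 0, ‖ns 0 z‖ = ‖A‖ := by
    rw [h0, Finset.sum_eq_single x]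
    · rw [Pi.single_eq_same]
    · intro z _ hz; rw [Pi.single_eq_of_ne hz, norm_zero]
    · intro hx; exact absurd (Finset.mem_univ x) hx
  have htot := sum_norm_avgSeq_le V hV ns hsucc k hk
  rw [hmass] at htot
  exact (Finset.single_le_sum (fun z _ => norm_nonneg (ns k z)) (Finset.mem_univ y)).trans htot

end Summit.QuantumFields.YangMills.Theorems.Prop7AvgSeqSpikeMass

end
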